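import Summits.CriticalPhenomena.PercolationContinuityZ3.Theorems.PercNearOneGluingNoHeavyQuantSDEC
import HarnessLib

/-!
# QUANT lane R8, T-DEC: gate-stable DEC at the TIGHT floor — sure blocks `δ_M` are SDEC at every floor `≤ 1`, and the extraction lemma

builds on p205010 (kernel theorem, internal audit signed; external expert review pending)

Support file (`--supports stmt-CriticalPhenomena-4575`), QUANT lane seat prim-quant-census-2 (gen 53), rung R8 of
`run/shared/lean/prim/quant/LADDER.md`.  Follow-up to `…QuantSDEC` (p267007); memo `…/prim-quant-census-2-g53/DEC-CLOSURE-G53.md` §4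
(CAVEAT).  Theorems only, standard axioms.

WHY.  `LawDec.TreeBuilt` keeps its base laws at floors `< 1`, so the structural induction `decAt_of_treeBuilt` reaches a forest law at
every floor STRICTLY below its least marginal.  For the tight floor (= the least marginal, the case `1 − t = min marginal` of `Quant.TreeDEC`)
the forest recursion should be run on `LawDec.SDEC` directly: sure blocks (all gates `1`) are the point laws `δ_M`, which are SDEC at EVERY
floor `0 < x ≤ 1` (this file), a relay hung at gate `q` is then SDEC at floor exactly `q` (`sdec_gate`), non-sure parts have floor `< 1` so
`sdec_mono` applies, and `SDECConvClosed` does the independent sums.  `decAt_of_sdec` extracts DEC(j′) at every layer at the end.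

* `LawDec.sdec_point` — for `0 < x ≤ 1` and every `M`, `SDEC x M δ_M` (the gated point law `{0: 1−q, M: q}` at floor `x′ = q·x ≤ q` is
  criterion E: `x′(1−q) ≤ (1−x′)q ⟺ x′ ≤ q`).
* `LawDec.sdec_gate_point` — a sure block of `M` relays hung at gate `0 < q ≤ 1` is SDEC at floor exactly `q`.
* `LawDec.decAt_of_sdec` — `SDEC x M μ`, law facts, `x·M ≤ mean`, `0 < x < 1` ⟹ `DECAt x j′ M μ` for every `j′`.

[this work]; DEC rules ARCH-TREES-G49 §2.2 / DEC-TAMP-G50 §3.1 (this lane).  The gluing rows served [cite: KozmaNitzan2024, Conjecture 3 (p. 15)];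
product measure [cite: Grimmett1999, §1.3 p. 10].
-/

noncomputable section

namespace Summit.CriticalPhenomena.PercolationContinuityZ3.Theorems

namespace Quant

open Finset

namespace LawDec

/-- **Sure blocks are SDEC at every floor `0 < x ≤ 1`.** [this work] -/
theorem sdec_point (x : ℝ) (hx0 : 0 < x) (hx1 : x ≤ 1) (M : ℕ) : SDEC x M (fun h => if h = M then (1 : ℝ) else 0) := by
  intro q hq0 hq1 j' hj
  set μ : ℕ → ℝ := gate (fun h => if h = M then (1 : ℝ) else 0) q with hμ
  have hμ0 : ∀ h, 0 ≤ μ h := by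
    intro h; simp only [hμ, gate]; split_ifs <;> nlinarith
  have hμM : ∀ h, M < h → μ h = 0 := by
    intro h hh; simp only [hμ, gate]; rw [if_neg (by omega), if_neg (by omega)]; ring
  have hsum : ∀ s : Finset ℕ, ∑ h ∈ s, μ h = q * (if M ∈ s then 1 else 0) + (if (0 : ℕ) ∈ s then 1 - q else 0) := by
    intro s
    simp only [hμ, gate]
    rw [Finset.sum_add_distrib, ← Finset.mul_sum, Finset.sum_ite_eq' s M, Finset.sum_ite_eq' s 0]
  have hμ1 : ∑ h ∈ Finset.range (M + 1), μ h = 1 := by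
    rw [hsum, if_pos (Finset.mem_range.2 (Nat.lt_succ_self M)), if_pos (Finset.mem_range.2 (Nat.succ_pos M))]; ring
  refine decAt_of_giantsAbsorbLows (q * x) j' M μ hj hμ0 hμM hμ1 (mul_pos hq0 hx0) ?_
  -- low mass ≤ the mass below the layer = 1 − q; giant mass = q
  have hlow : ∑ h ∈ Finset.range (j' + 1),
      (if 2 * (h : ℝ) < ∑ k ∈ Finset.range (M + 1), (k : ℝ) * μ k then μ h else 0) ≤ 1 - q := by
    calc ∑ h ∈ Finset.range (j' + 1), (if 2 * (h : ℝ) < ∑ k ∈ Finset.range (M + 1), (k : ℝ) * μ k then μ h else 0)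
        ≤ ∑ h ∈ Finset.range (j' + 1), μ h := Finset.sum_le_sum fun h _ => by split_ifs <;> [exact le_rfl; exact hμ0 h]
      _ = 1 - q := by
          rw [hsum, if_neg (fun hm => by have := Finset.mem_range.1 hm; omega),
            if_pos (Finset.mem_range.2 (Nat.succ_pos j'))]; ring
  have hG : ∑ h ∈ Finset.Ico (j' + 1) (M + 1), μ h = q := by
    rw [hsum, if_pos (Finset.mem_Ico.2 ⟨by omega, Nat.lt_succ_self M⟩),
      if_neg (fun hm => by have := (Finset.mem_Ico.1 hm).1; omega)]; ring
  rw [hG]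
  have h1 := mul_le_mul_of_nonneg_left hlow (mul_pos hq0 hx0).le
  nlinarith [mul_pos hq0 hx0, hq1, hx1]

/-- **A sure block of `M` relays hung at gate `0 < q ≤ 1` is SDEC at floor exactly `q`.** [this work] -/
theorem sdec_gate_point (q : ℝ) (hq0 : 0 < q) (hq1 : q ≤ 1) (M : ℕ) :
    SDEC q M (gate (fun h => if h = M then (1 : ℝ) else 0) q) := by
  have := sdec_gate (sdec_point 1 one_pos le_rfl M) q hq0 hq1
  rwa [mul_one] at this

/-- **Extraction**: an SDEC law (with its law facts and `x·M ≤ mean`, `0 < x < 1`) is DEC(j′) at EVERY layer — below the top by the gate `q = 1`,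
at and above the top by Theorem A. [this work] -/
theorem decAt_of_sdec {x : ℝ} {M : ℕ} {μ : ℕ → ℝ} (hs : SDEC x M μ) (hx0 : 0 < x) (hx1 : x < 1)
    (hμ0 : ∀ h, 0 ≤ μ h) (hμM : ∀ h, M < h → μ h = 0) (hμ1 : ∑ h ∈ Finset.range (M + 1), μ h = 1)
    (htop : x * (M : ℝ) ≤ ∑ h ∈ Finset.range (M + 1), (h : ℝ) * μ h) (j' : ℕ) : DECAt x j' M μ := by
  by_cases hj : j' < M
  · have := hs 1 one_pos le_rfl j' hj
    rwa [gate_one, one_mul] at this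
  · refine decAt_of_top_le M μ hμ0 hμM hμ1 x hx1 (fun k hk => ?_) j' (not_lt.1 hj)
    have hkM : k ≤ M := by
      by_contra hlt
      exact absurd (hμM k (not_le.1 hlt)) (ne_of_gt hk)
    have : x * (k : ℝ) ≤ x * (M : ℝ) := mul_le_mul_of_nonneg_left (by exact_mod_cast hkM) hx0.le
    linarith

end LawDec

end Quant

end Summit.CriticalPhenomena.PercolationContinuityZ3.Theorems
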